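/-
Copyright (c) 2026. All rights reserved.
Released under Apache 2.0 license as described in the file LICENSE.
Authors: abc-iut cell, prover seat abc-iut-f-101 (F fact-proving wave), over the statements of abc-iut-L4-t3.
-/
import Literature.AnabelianGeometry.AbsoluteAnabelian.DiagramChainFamilies
import Literature.AnabelianGeometry.AbsoluteAnabelian.Ltimes.LogFrobeniusCorollaries
import Literature.AnabelianGeometry.AbsoluteAnabelian.LogFrobeniusObservablesMoves
import HarnessLib

/-!
# [AbsTopIII] Corollary 5.5 (iii), `⊞`-half: the MOVE SYSTEM of the observable `S_log⊞` on `D•_{≤2} ∪ {𝒩⊞_v}` — generators, homotopies, termination, unique decomposition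

S. Mochizuki, *Topics in absolute anabelian geometry III: global reconstruction algorithms*,
J. Math. Sci. Univ. Tokyo 22 (2015) 939–1156 [MochizukiAbsTopIII2015]; locators `p.N` = pages of the author's
manuscript (`paper:url-5493eb38cbb7`): Def 5.4 (iii) p. 126, (v) p. 127, (vii) p. 128 (the graphs `Γ⃗^log_v`,
the twist `Λ_ν`, the `ι⊞_{v,ε}`), Cor 5.5 (iii) p. 131 (the observable `S_log⊞` on `D•_{≤2}` determined by the
`ι⊞_{v,ε}`), §0 p. 26 / Def 3.5 (ii) p. 75 (saturation; families of homotopies).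

Preparation for the CONSTRUCTION of the observable `S_log⊞` of Cor 5.5 (iii) as typed by abc-iut-L4-t3
(`LogFrobeniusSetting.IsLogObservablePlus`, `Cor55Observables` = FACT-LIST F-0142) from the commutativity of the
`ι⊞`-squares (the converse of `iota_comp_eq_of_cor55Observables`, `LogFrobeniusObservablesIotaSquare.lean`), via the
generated-family toolkit `DiagramChainFamilies.lean`.  The boundary set of `S_log⊞` is the saturation of the two
printed kinds of pairs; this file sets up the corresponding MOVE SYSTEM on the paths of `D•_{≤2} ∪ {𝒩⊞_v}` ending at
`𝒩⊞_v`: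

* `LogFrobeniusSetting.LogGen` — the generator pairs: (`pre`) `([λ⊞_{ν₁}], [λ⊞_{ν₂}])` for an `ι⊞`-carrying edge
  `ν₁ → ν₂` between pre-log vertices, (`post`) `([λ⊞_{sl}]∘[id_⋎]∘[log], [λ⊞_{ν₂}]∘[id_{⋎+1}])` for the edge out of
  the post-log vertex; `logGenHom` — their prescribed homotopies `ι⊞_{v,ε}`, re-typed along the identifications of
  the path functors (`pathFunctor_lamPath`, `pathFunctor_postLogDomPath`, …: `𝒟_[λ⊞_ν] = Λ_ν ⋙ λ⊞_ν`, using the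
  proviso `λ⊞_{sl} = λ⊞_{post-log}` of Cor 5.5);
* TERMINATION: a rank on the vertices of `Γ⃗^log_v` (`LogVertex.rank`) decreasing along the `ι⊞`-carrying edges
  (`rank_lt_of_logEdge`, `rank_lt_of_logEdge_post`), the induced weight of paths (`DEdge.wt`, `edgeWt`, `pathWt`,
  additive: `pathWt_comp`), and `pathWt_lt_of_move` / `pathWt_le_of_chain` / `pathWt_lt_of_cons`: every move of the
  toolkit's `Move (LogGen v)` strictly lowers the weight — no loops, well-founded;
* LOCAL STRUCTURE of `Γ⃗^log_v`, uniformly in the Boolean "archimedean" (`LogVertex.logEdge_subsingleton`,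
  `isEmpty_logEdge_spaceLink`, `logEdge_post_target_eq`, `logEdge_fork`: the only fork out of a pre-log vertex is the
  nonarchimedean `𝒪^×_k̄ → {k̄^×, k~}`, closing at once into `(k̄^×)^pf` — the commutative square of Def 5.4 (iii));
* UNIQUE DECOMPOSITION of paths into `𝒩⊞_v` (`eq_of_comp_lamPath_eq`, `eq_of_comp_lamPath_eq_comp_postLogDomPath`,
  `eq_of_comp_postLogDomPath_eq`): the first move of a chain out of a path is determined by the path up to the fork.

Nothing is asserted about print here (definitions and bookkeeping over the typed interface); the coherence theorem and
the construction of `S_log⊞` are in `LogFrobeniusObservablesOfIotaSquare.lean`.  Refereed pre-IUT material; nothing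
here bears on [IUTchIII] Cor. 3.12; no side taken.

**`⋉`-TWIN (cell row «LTIMES-SUCCESSOR», L4-lead m162; typing finding T3g9-F1).**  This file is the verbatim
re-elaboration of `LogFrobeniusObservablesMoves.lean` over the successor interface `LogFrobeniusSettingLtimes`
(`Ltimes/LogFrobeniusCompatibility.lean`: `ι⊞_{v,ε}` indexed by the edges of `Γ⃗^⋉_v` at EVERY place, [AbsTopIII] Cor 5.5 (iii)
p. 131), produced by the cell recipe `LTIMES-RECIPE.md`: names carry over inside `namespace LogFrobeniusSettingLtimes`, the
section variable is `Lt`, setting-independent declarations are NOT repeated (the originals are in scope), statements and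
proofs are otherwise unchanged.  The original file over the frozen interface stays as it is.
SLICE T9 «LTIMES-OBSERVABLES» (abc-iut-f-101 gen 6), file 1: here the successor CHANGES the index set — the
`ι⊞`-carrying edges are `LogEdgeLtimes` (`Γ⃗^⋉_v` at EVERY place: at an archimedean `v` only `k~ → k~ ↠ k^×`, Cor 5.5 (iii)
p. 131) — so the move system `LogGen` / `logGenHom` and the weights are re-declared over the `⋉`-edges (the weights
`edgeWt`/`pathWt` over this namespace's `logShapePlus`), while the local structure of `Γ⃗^⋉_v` (`LogEdgeLtimes.rank_lt`,
`.subsingleton_edge`, `.isEmpty_spaceLink_out`, `.post_target_eq`, `.fork`, …) is TRANSFERRED from the frozen lemmas on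
`Γ⃗^log_v` along the inclusion `LogEdgeLtimes.toOld` (injective: `toOld_injective`); `LogVertex.rank`, `DEdge.wt` and the
generic `DiagramChainFamilies` are reused.
-/

set_option autoImplicit false

universe u

open CategoryTheory Quiver

namespace Literature.AnabelianGeometry.AbsoluteAnabelian

/-! ## Combinatorics of `Γ⃗^log_v`: a rank decreasing along the `ι⊞`-carrying edges; forks; sinks -/

namespace LogEdgeLtimes

/-! The rank `LogVertex.rank` and the frozen combinatorics of `Γ⃗^log_v` (`LogFrobeniusObservablesMoves.lean`) are
reused; the `⋉`-edges `LogEdgeLtimes` are a SUB-family of the frozen `LogEdge` (`toOld`: the identity at a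
nonarchimedean place, the inclusion `{e : ArchEdge // e.InLeft} ↪ ArchEdge` at an archimedean one), so every
"at most one / no edge" statement transfers along `toOld`, and the fork statement is re-proved by the same case analysis. -/

/-- The rank decreases along every `ι⊞`-carrying `⋉`-edge out of a pre-log vertex (`Γ⃗^⋉_non`: `𝒪^× ↪ k̄^×`,
`𝒪^× → k~`, `k̄^× → (k̄^×)^pf`, `k~ ↪ (k̄^×)^pf`; `Γ⃗^⋉_arc`: `k~ ↠ k^×`). [cite: MochizukiAbsTopIII2015, Def 5.4 (iii) p. 126] -/
theorem rank_lt (b : Bool) {ν₁ ν₂ : LogVertex b} (ε : LogEdgeLtimes b ν₁ ν₂) (h₁ : ν₁.isPostLog = false) :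
    LogVertex.rank b ν₂ < LogVertex.rank b ν₁ :=
  LogVertex.rank_lt_of_logEdge b ε.toOld h₁

/-- The target of the post-log edge has rank `< 3 + rank (space-link)`. [cite: MochizukiAbsTopIII2015, Def 5.4 (iii) p. 126] -/
theorem rank_lt_post (b : Bool) {ν₁ ν₂ : LogVertex b} (ε : LogEdgeLtimes b ν₁ ν₂) (h₁ : ν₁.isPostLog = true) :
    LogVertex.rank b ν₂ < 3 + LogVertex.rank b (LogVertex.spaceLink b) :=
  LogVertex.rank_lt_of_logEdge_post b ε.toOld h₁

/-- `toOld` is injective (a `⋉`-edge is a frozen edge with a property). [cite: MochizukiAbsTopIII2015, Def 5.4 (iii) p. 126] -/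
theorem toOld_injective (b : Bool) {ν₁ ν₂ : LogVertex b} :
    Function.Injective (toOld : LogEdgeLtimes b ν₁ ν₂ → AbsoluteAnabelian.LogEdge b ν₁ ν₂) := by
  cases b
  · exact fun _ _ h => h
  · exact fun _ _ h => Subtype.ext h

/-- There is at most one `ι⊞`-carrying `⋉`-edge between two vertices of `Γ⃗^log_v`. [cite: MochizukiAbsTopIII2015, Def 5.4 (iii) p. 126] -/
theorem subsingleton_edge (b : Bool) {ν₁ ν₂ : LogVertex b} (ε ε' : LogEdgeLtimes b ν₁ ν₂) : ε = ε' :=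
  toOld_injective b (LogVertex.logEdge_subsingleton b ε.toOld ε'.toOld)

/-- The space-link vertex has no outgoing `⋉`-edge (it is a sink: `k̄`, resp. `k`).
[cite: MochizukiAbsTopIII2015, Def 5.4 (iii) p. 126] -/
theorem isEmpty_spaceLink_out (b : Bool) (ν : LogVertex b) : IsEmpty (LogEdgeLtimes b (LogVertex.spaceLink b) ν) :=
  ⟨fun ε => (LogVertex.isEmpty_logEdge_spaceLink b ν).false ε.toOld⟩

/-- The source of a `⋉`-edge is not the space-link vertex. [cite: MochizukiAbsTopIII2015, Def 5.4 (iii) p. 126] -/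
theorem ne_spaceLink (b : Bool) {ν₁ ν₂ : LogVertex b} (ε : LogEdgeLtimes b ν₁ ν₂) :
    ν₁ ≠ LogVertex.spaceLink b := by
  rintro rfl
  exact (isEmpty_spaceLink_out b ν₂).false ε

/-- Out of the post-log vertex there is exactly one edge (the post-log arrow `k~ → k~`): its target is determined.
[cite: MochizukiAbsTopIII2015, Def 5.4 (iii) p. 126] -/
theorem post_target_eq (b : Bool) {ν₁ ν₂ ν₂' : LogVertex b} (h₁ : ν₁.isPostLog = true)
    (ε : LogEdgeLtimes b ν₁ ν₂) (ε' : LogEdgeLtimes b ν₁ ν₂') : ν₂ = ν₂' :=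
  LogVertex.logEdge_post_target_eq b h₁ ε.toOld ε'.toOld

/-- Out of `k̄^×` the only `ι⊞`-carrying edge goes to `(k̄^×)^pf`. [cite: MochizukiAbsTopIII2015, Def 5.4 (iii) p. 126] -/
theorem eq_perf_of_mult {ν : LogVertex false} (γ : LogEdgeLtimes false NonarchVertex.mult ν) :
    ν = NonarchVertex.perf :=
  LogVertex.eq_perf_of_logEdge_mult γ.toOld

/-- Out of `k~` (the shell codomain) the only edge goes to `(k̄^×)^pf`. [cite: MochizukiAbsTopIII2015, Def 5.4 (iii) p. 126] -/
theorem eq_perf_of_shellCod {ν : LogVertex false} (γ : LogEdgeLtimes false NonarchVertex.shellCod ν) :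
    ν = NonarchVertex.perf :=
  LogVertex.eq_perf_of_logEdge_shellCod γ.toOld

/-- **The forks of `Γ⃗^⋉_v`.**  Two DISTINCT `ι⊞`-carrying `⋉`-edges out of one pre-log vertex exist only at a
nonarchimedean place, out of `𝒪^×_k̄` (towards `k̄^×` and `k~`), and the fork closes at once: both targets are pre-log
of the same rank and have exactly one outgoing edge, into a common pre-log vertex `(k̄^×)^pf` (the commutative square
of Def 5.4 (iii)); at an archimedean place `Γ⃗^⋉_arc` is linear.  Stated uniformly in the Boolean `b`.
[cite: MochizukiAbsTopIII2015, Def 5.4 (iii) p. 126] -/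
theorem fork (b : Bool) {ν₁ ν₂ ν₂' : LogVertex b} (h₁ : ν₁.isPostLog = false) (ε : LogEdgeLtimes b ν₁ ν₂)
    (ε' : LogEdgeLtimes b ν₁ ν₂') (hne : ν₂ ≠ ν₂') :
    ∃ (ν₃ : LogVertex b) (_ : LogEdgeLtimes b ν₂ ν₃) (_ : LogEdgeLtimes b ν₂' ν₃),
      ν₂.isPostLog = false ∧ ν₂'.isPostLog = false ∧ ν₃.isPostLog = false ∧
      LogVertex.rank b ν₂ = LogVertex.rank b ν₂' ∧
      (∀ (ν₄ : LogVertex b), LogEdgeLtimes b ν₂ ν₄ → ν₄ = ν₃) ∧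
      (∀ (ν₄ : LogVertex b), LogEdgeLtimes b ν₂' ν₄ → ν₄ = ν₃) := by
  cases b
  · obtain ⟨e, he⟩ := ε
    obtain ⟨e', he'⟩ := ε'
    cases e <;> cases e' <;>
      first
        | exact absurd rfl hne
        | exact he.elim
        | exact he'.elim
        | exact absurd h₁ (by decide)
        | exact ⟨NonarchVertex.perf, ⟨.multToPerf, trivial⟩, ⟨.shellCodToPerf, trivial⟩, by decide, by decide,
            by decide, rfl, fun _ γ => eq_perf_of_mult γ, fun _ γ => eq_perf_of_shellCod γ⟩
        | exact ⟨NonarchVertex.perf, ⟨.shellCodToPerf, trivial⟩, ⟨.multToPerf, trivial⟩, by decide, by decide,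
            by decide, rfl, fun _ γ => eq_perf_of_shellCod γ, fun _ γ => eq_perf_of_mult γ⟩
  · obtain ⟨e, -⟩ := ε
    obtain ⟨e', -⟩ := ε'
    revert e e'
    change ArchEdge _ _ → ArchEdge _ _ → _
    intro e e'
    cases e <;> cases e' <;> exact absurd rfl hne

end LogEdgeLtimes

/-! ## The move system of `D•_{≤2} ∪ {𝒩⊞_v}`: weights, generators, homotopies -/

namespace LogFrobeniusSettingLtimes

variable {Vmod : Type u} {isArc : Vmod → Bool} (Lt : LogFrobeniusSettingLtimes Vmod isArc) (v : Vmod)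

/-- The weight of an arrow of `D•_{≤2} ∪ {𝒩⊞_v}` (that of the underlying arrow of `D•⊢`).
[cite: MochizukiAbsTopIII2015, Cor 5.5 (iii) p. 131] -/
def edgeWt : {c d : (logShapePlus (isArc := isArc) v).Vertex} → (c ⟶ d) → ℕ
  | ExtVertex.base _, ExtVertex.base _, e => DEdge.wt e
  | ExtVertex.base _, ExtVertex.obs, e => DEdge.wt e
  | ExtVertex.obs, _, _ => 0

/-- The weight of a path of `D•_{≤2} ∪ {𝒩⊞_v}` (sum of the weights of its arrows).
[cite: MochizukiAbsTopIII2015, Cor 5.5 (iii) p. 131] -/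
def pathWt {c : (logShapePlus (isArc := isArc) v).Vertex} :
    {d : (logShapePlus (isArc := isArc) v).Vertex} → Path c d → ℕ
  | _, Path.nil => 0
  | _, Path.cons p e => pathWt p + edgeWt v e

/-- The weight is additive along composition of paths. [cite: MochizukiAbsTopIII2015, Cor 5.5 (iii) p. 131] -/
theorem pathWt_comp {c d d' : (logShapePlus (isArc := isArc) v).Vertex} (r : Path c d) :
    ∀ (p : Path d d'), LogFrobeniusSettingLtimes.pathWt v (r.comp p) = pathWt v r + pathWt v p
  | Path.nil => rfl
  | Path.cons p e => by rw [Path.comp_cons, pathWt, pathWt, pathWt_comp r p, Nat.add_assoc]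

/-- Weight of `[λ⊞_{v,ν}]`. [cite: MochizukiAbsTopIII2015, Cor 5.5 (iii) p. 131] -/
theorem pathWt_lamPath (ν : LogVertex (isArc v)) (hν : ν.isPostLog = false) :
    LogFrobeniusSettingLtimes.pathWt v (lamPath (isArc := isArc) v ν hν) = LogVertex.rank _ ν := by
  show 0 + LogVertex.rank _ ν = _
  exact Nat.zero_add _

/-- Weight of `[λ⊞_{sl}] ∘ [id_⋎] ∘ [log]`. [cite: MochizukiAbsTopIII2015, Cor 5.5 (iii) p. 131] -/
theorem pathWt_postLogDomPath (n : ℤ) (hsl : (LogVertex.spaceLink (isArc v)).isPostLog = false) :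
    LogFrobeniusSettingLtimes.pathWt v (postLogDomPath (isArc := isArc) v n hsl) = 3 + LogVertex.rank _ (LogVertex.spaceLink (isArc v)) := by
  show ((0 + 3) + 0) + LogVertex.rank _ (LogVertex.spaceLink (isArc v)) = _
  omega

/-- Weight of `[λ⊞_{ν₂}] ∘ [id_{⋎+1}]`. [cite: MochizukiAbsTopIII2015, Cor 5.5 (iii) p. 131] -/
theorem pathWt_postLogCodPath (n : ℤ) (ν₂ : LogVertex (isArc v)) (h₂ : ν₂.isPostLog = false) :
    LogFrobeniusSettingLtimes.pathWt v (postLogCodPath (isArc := isArc) v n ν₂ h₂) = LogVertex.rank _ ν₂ := by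
  show (0 + 0) + LogVertex.rank _ ν₂ = _
  omega

/-- **The generator pairs of the observable `S_log⊞`** (Cor 5.5 (iii)): (`pre`) `([λ⊞_{ν₁}], [λ⊞_{ν₂}])` for an
`ι⊞`-carrying edge `ε : ν₁ → ν₂` between pre-log vertices; (`post`) `([λ⊞_{sl}]∘[id_⋎]∘[log], [λ⊞_{ν₂}]∘[id_{⋎+1}])` for
an edge out of the post-log vertex. [cite: MochizukiAbsTopIII2015, Cor 5.5 (iii) p. 131] -/
inductive LogGen : ∀ ⦃c b : (logShapePlus (isArc := isArc) v).Vertex⦄, Path c b → Path c b → Type u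
  | pre (ν₁ ν₂ : LogVertex (isArc v)) (ε : LogEdgeLtimes (isArc v) ν₁ ν₂) (h₁ : ν₁.isPostLog = false)
      (h₂ : ν₂.isPostLog = false) : LogGen (lamPath v ν₁ h₁) (lamPath v ν₂ h₂)
  | post (ν₁ ν₂ : LogVertex (isArc v)) (ε : LogEdgeLtimes (isArc v) ν₁ ν₂) (h₁ : ν₁.isPostLog = true)
      (h₂ : ν₂.isPostLog = false) (hsl : (LogVertex.spaceLink (isArc v)).isPostLog = false) (n : ℤ) :
      LogGen (postLogDomPath v n hsl) (postLogCodPath v n ν₂ h₂)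

/-- The path functor of `[λ⊞_{ν}]` is `Λ_ν ⋙ λ⊞_ν` (`Λ_ν = 𝟭` at a pre-log vertex).
[cite: MochizukiAbsTopIII2015, Def 5.4 (vii) p. 128] -/
theorem pathFunctor_lamPath (ν : LogVertex (isArc v)) (hν : ν.isPostLog = false) :
    (Lt.logDiagramPlus v).pathFunctor (lamPath v ν hν) = frobeniusTwist Lt.log ν.isPostLog ⋙ Lt.lam v ν := by
  rw [lamPath, DiagramOfCategories.pathFunctor_cons, DiagramOfCategories.pathFunctor_nil, hν]
  rfl

/-- … and is `λ⊞_ν` itself (with `𝟭 ⋙ -` removed). [cite: MochizukiAbsTopIII2015, Def 5.4 (vii) p. 128] -/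
theorem pathFunctor_lamPath' (ν : LogVertex (isArc v)) (hν : ν.isPostLog = false) :
    Lt.lam v ν = (Lt.logDiagramPlus v).pathFunctor (lamPath v ν hν) := by
  rw [lamPath, DiagramOfCategories.pathFunctor_cons, DiagramOfCategories.pathFunctor_nil]
  exact (Functor.id_comp _).symm

/-- The path functor of `[λ⊞_{sl}]∘[id_⋎]∘[log]` is `Λ_{ν₁} ⋙ λ⊞_{ν₁}` for the post-log vertex `ν₁` (`Λ = log`, and
`λ⊞_{sl} = λ⊞_{post-log}` by the proviso of Cor 5.5). [cite: MochizukiAbsTopIII2015, Def 5.4 (vii) p. 128] -/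
theorem pathFunctor_postLogDomPath (ν₁ : LogVertex (isArc v)) (h₁ : ν₁.isPostLog = true) (n : ℤ)
    (hsl : (LogVertex.spaceLink (isArc v)).isPostLog = false) :
    (Lt.logDiagramPlus v).pathFunctor (postLogDomPath v n hsl) = frobeniusTwist Lt.log ν₁.isPostLog ⋙ Lt.lam v ν₁ := by
  rw [postLogDomPath, DiagramOfCategories.pathFunctor_cons, DiagramOfCategories.pathFunctor_cons,
    DiagramOfCategories.pathFunctor_cons, DiagramOfCategories.pathFunctor_nil, h₁,
    LogVertex.eq_postLog_of_isPostLog _ h₁, ← Lt.lam_spaceLink_eq_postLog v]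
  rfl

/-- The path functor of `[λ⊞_{ν₂}]∘[id_{⋎+1}]` is `λ⊞_{ν₂}`. [cite: MochizukiAbsTopIII2015, Def 5.4 (vii) p. 128] -/
theorem pathFunctor_postLogCodPath (n : ℤ) (ν₂ : LogVertex (isArc v)) (h₂ : ν₂.isPostLog = false) :
    Lt.lam v ν₂ = (Lt.logDiagramPlus v).pathFunctor (postLogCodPath v n ν₂ h₂) := by
  rw [postLogCodPath, DiagramOfCategories.pathFunctor_cons, DiagramOfCategories.pathFunctor_cons,
    DiagramOfCategories.pathFunctor_nil]
  rfl

/-- **The prescribed homotopies of the generators**: `ι⊞_{v,ε}`, re-typed along the identifications of the path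
functors. [cite: MochizukiAbsTopIII2015, Cor 5.5 (iii) p. 131] -/
noncomputable def logGenHom : ∀ ⦃c b : (logShapePlus (isArc := isArc) v).Vertex⦄ ⦃g g' : Path c b⦄,
    LogGen v g g' → ((Lt.logDiagramPlus v).pathFunctor g ⟶ (Lt.logDiagramPlus v).pathFunctor g')
  | _, _, _, _, LogGen.pre ν₁ ν₂ ε h₁ h₂ =>
    eqToHom (Lt.pathFunctor_lamPath v ν₁ h₁) ≫ Lt.iota v ε ≫ eqToHom (Lt.pathFunctor_lamPath' v ν₂ h₂)
  | _, _, _, _, LogGen.post ν₁ ν₂ ε h₁ h₂ hsl n =>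
    eqToHom (Lt.pathFunctor_postLogDomPath v ν₁ h₁ n hsl) ≫ Lt.iota v ε ≫ eqToHom (Lt.pathFunctor_postLogCodPath v n ν₂ h₂)

/-! ## Termination: every move lowers the weight -/

/-- **Every move lowers the weight of the path** (by `rank_lt_of_logEdge`, `rank_lt_of_logEdge_post`): the move
system terminates and has no loops. [cite: MochizukiAbsTopIII2015, Cor 5.5 (iii) p. 131] -/
theorem pathWt_lt_of_move {a : (logShapePlus (isArc := isArc) v).Vertex} {p p' : Path a (logShapePlus v).obs}
    (m : DiagramOfCategories.Move (LogFrobeniusSettingLtimes.LogGen v) p p') : pathWt v p' < pathWt v p := by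
  obtain ⟨c, r, g, g', s, hp, hp'⟩ := m
  cases s with
  | pre ν₁ ν₂ ε h₁ h₂ =>
    rw [hp, hp', pathWt_comp, pathWt_comp, pathWt_lamPath, pathWt_lamPath]
    exact Nat.add_lt_add_left (LogEdgeLtimes.rank_lt _ ε h₁) _
  | post ν₁ ν₂ ε h₁ h₂ hsl n =>
    rw [hp, hp', pathWt_comp, pathWt_comp, pathWt_postLogDomPath, pathWt_postLogCodPath]
    exact Nat.add_lt_add_left (LogEdgeLtimes.rank_lt_post _ ε h₁) _

/-- Along a chain of moves the weight does not increase. [cite: MochizukiAbsTopIII2015, Cor 5.5 (iii) p. 131] -/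
theorem pathWt_le_of_chain {a : (logShapePlus (isArc := isArc) v).Vertex} {p q : Path a (logShapePlus v).obs}
    (c : DiagramOfCategories.Chain (LogFrobeniusSettingLtimes.LogGen v) p q) : pathWt v q ≤ pathWt v p := by
  induction c with
  | nil p => exact le_rfl
  | cons m rest ih => exact ih.trans (pathWt_lt_of_move v m).le

/-- A chain with a first move strictly lowers the weight. [cite: MochizukiAbsTopIII2015, Cor 5.5 (iii) p. 131] -/
theorem pathWt_lt_of_cons {a : (logShapePlus (isArc := isArc) v).Vertex} {p p' q : Path a (logShapePlus v).obs}
    (m : DiagramOfCategories.Move (LogFrobeniusSettingLtimes.LogGen v) p p') (rest : DiagramOfCategories.Chain (LogGen v) p' q) :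
    pathWt v q < pathWt v p :=
  (pathWt_le_of_chain v rest).trans_lt (pathWt_lt_of_move v m)

/-! ## Unique decomposition of the paths of `D•_{≤2} ∪ {𝒩⊞_v}` ending at `𝒩⊞_v` -/

/-- Two presentations `p = [λ⊞_ν] ∘ r = [λ⊞_{ν'}] ∘ r'` have the same last arrow and the same prefix.
[cite: MochizukiAbsTopIII2015, Cor 5.5 (iii) p. 131] -/
theorem eq_of_comp_lamPath_eq {a : (logShapePlus (isArc := isArc) v).Vertex}
    {r r' : Path a ((logShapePlus (isArc := isArc) v).base ⟨.core, core_mem_two⟩)} {ν ν' : LogVertex (isArc v)}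
    {h : ν.isPostLog = false} {h' : ν'.isPostLog = false}
    (e : r.comp (LogFrobeniusSettingLtimes.lamPath v ν h) = r'.comp (lamPath v ν' h')) : ν = ν' ∧ r = r' := by
  change r.cons (lamEdge v ν h) = r'.cons (lamEdge v ν' h') at e
  have hν : lamEdge (isArc := isArc) v ν h = lamEdge v ν' h' := eq_of_heq (Path.hom_heq_of_cons_eq_cons e)
  have hr : r = r' := eq_of_heq (Path.heq_of_cons_eq_cons e)
  refine ⟨?_, hr⟩
  change DEdge.lam v ν h = DEdge.lam v ν' h' at hν
  injection hν

/-- A presentation `[λ⊞_ν] ∘ r = ([λ⊞_{sl}] ∘ [id_⋎] ∘ [log]) ∘ r'` forces `ν = sl` and `r = [id_⋎] ∘ [log] ∘ r'`.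
[cite: MochizukiAbsTopIII2015, Cor 5.5 (iii) p. 131] -/
theorem eq_of_comp_lamPath_eq_comp_postLogDomPath {a : (logShapePlus (isArc := isArc) v).Vertex}
    {r : Path a ((logShapePlus (isArc := isArc) v).base ⟨.core, core_mem_two⟩)} {ν : LogVertex (isArc v)}
    {h : ν.isPostLog = false} {n : ℤ} {r' : Path a ((logShapePlus (isArc := isArc) v).base ⟨.row1 (n + 1), row1_mem_two (n + 1)⟩)}
    {hsl : (LogVertex.spaceLink (isArc v)).isPostLog = false}
    (e : r.comp (LogFrobeniusSettingLtimes.lamPath v ν h) = r'.comp (postLogDomPath v n hsl)) :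
    ν = LogVertex.spaceLink (isArc v) ∧ r = (r'.cons (logEdge v n)).cons (toCoreEdge v n) := by
  change r.cons (lamEdge v ν h) = ((r'.cons (logEdge v n)).cons (toCoreEdge v n)).cons (lamEdge v _ hsl) at e
  have hν : lamEdge (isArc := isArc) v ν h = lamEdge v _ hsl := eq_of_heq (Path.hom_heq_of_cons_eq_cons e)
  have hr : r = (r'.cons (logEdge v n)).cons (toCoreEdge v n) := eq_of_heq (Path.heq_of_cons_eq_cons e)
  refine ⟨?_, hr⟩
  change DEdge.lam v ν h = DEdge.lam v _ hsl at hν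
  injection hν

/-- Two presentations `([λ⊞_{sl}] ∘ [id_⋎] ∘ [log]) ∘ r = ([λ⊞_{sl}] ∘ [id_{⋎'}] ∘ [log]) ∘ r'` have `⋎ = ⋎'` and `r = r'`.
[cite: MochizukiAbsTopIII2015, Cor 5.5 (iii) p. 131] -/
theorem eq_of_comp_postLogDomPath_eq {a : (logShapePlus (isArc := isArc) v).Vertex} {n n' : ℤ}
    {r : Path a ((logShapePlus (isArc := isArc) v).base ⟨.row1 (n + 1), row1_mem_two (n + 1)⟩)}
    {r' : Path a ((logShapePlus (isArc := isArc) v).base ⟨.row1 (n' + 1), row1_mem_two (n' + 1)⟩)}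
    {hsl hsl' : (LogVertex.spaceLink (isArc v)).isPostLog = false}
    (e : r.comp (LogFrobeniusSettingLtimes.postLogDomPath v n hsl) = r'.comp (postLogDomPath v n' hsl')) : n = n' ∧ HEq r r' := by
  change ((r.cons (logEdge v n)).cons (toCoreEdge v n)).cons (lamEdge v _ hsl) =
    ((r'.cons (logEdge v n')).cons (toCoreEdge v n')).cons (lamEdge v _ hsl') at e
  have e₂ : (r.cons (logEdge v n)).cons (toCoreEdge v n) = (r'.cons (logEdge v n')).cons (toCoreEdge v n') :=
    eq_of_heq (Path.heq_of_cons_eq_cons e)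
  have hn : ((logShapePlus (isArc := isArc) v).base ⟨.row1 n, row1_mem_two n⟩) =
      (logShapePlus (isArc := isArc) v).base ⟨.row1 n', row1_mem_two n'⟩ := Path.obj_eq_of_cons_eq_cons e₂
  have hn' : n = n' := by
    change ExtVertex.base _ = ExtVertex.base _ at hn
    injection hn with hn
    injection hn with hn
    injection hn
  subst hn'
  have e₃ : r.cons (logEdge v n) = r'.cons (logEdge v n) := eq_of_heq (Path.heq_of_cons_eq_cons e₂)
  exact ⟨rfl, Path.heq_of_cons_eq_cons e₃⟩

end LogFrobeniusSettingLtimes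

end Literature.AnabelianGeometry.AbsoluteAnabelian
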